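import Summits.AnomalousDissipation.AnomalousDissipation.Theses.NeutralTaylorWaves
import Summits.AnomalousDissipation.AnomalousDissipation.Theorems.NewtonRealisation.Negative.AxialShearCalculus
import Literature.Analysis.FluidPDE.CheskidovAssemblyTools
import Literature.Analysis.FunctionSpaces.TorusLinearisedFormTruncation
import Literature.Analysis.FunctionSpaces.TorusLinearisedNSEnergy

/-!
# Negative lemmas for crux `NeutralTaylorWaves.NewtonRealisation` (stmt-AnomalousDissipation-16315):
# the bordered a-priori bound is INHABITED by the axial shear state

The crux's only spectral input is the BORDERED `L²` a-priori bound (last clause of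
`NonresonantTaylorWaves`; hypothesis `BorderedBound ν M u₀ c` of the picked line's transfer
`C⁺ = stub_quantPersistenceCore`, `Cruxes/NewtonRealisation/Lines/Sketch.lean`).  No state carrying
it had been exhibited; were the clause unsatisfiable as typed (a sign slip in the convective terms
would do it) the crux would be vacuous.  Kernel-checked here (refuter cdisprove, 2026-08-17):

* `borderedBound_shear` — for EVERY viscosity `ν > 0` the axial shear state `u₀ = ν sin(2πx₃) e₀`
  (`Torus.stokesMode e₃ (νe₀) false`), drift `c = 0`, carries the bordered bound — verbatim the
  crux clause — with the explicit constant `M = 5ν⁻¹`: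
  `‖v‖₂² + b² ≤ (5/ν)² (‖u₀·∇v + v·∇u₀ − νΔv + ∇r − 0·∂₃v − b∂₃u₀‖₂² + ⟨v, ∂₃u₀⟩²)` for all smooth
  divergence-free mean-zero `v`, smooth `r`, real `b`.

Energy method: `pairing_self` (pair the image `G` with `v`: transport `∫⟨u₀·∇v, v⟩ = 0`, stretching
`≥ −2π‖a‖‖v‖₂²`, `∫⟨Δv,v⟩ = −‖∇v‖²`, Poincaré `4π²`) gives `(4π²ν − 2π‖a‖)‖v‖₂² ≤ ‖G‖₂‖v‖₂ + |b||s|`;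
`pairing_cos` (pair with the cosine partner `C = cos(2πx₃) a`: transport vanishes by antisymmetry
and `(u₀·∇)C = 0`, `ΔC = −4π²C`, `∇r ⊥ C`, border pairing `∫⟨∂₃u₀, C⟩ = π‖a‖²`) gives
`|b|π‖a‖² ≤ 2π‖a‖²‖v‖₂ + 4π²ν|∫⟨v,C⟩| + ‖G‖₂‖a‖`; with `a = νe₀` and `s = 2π∫⟨v,C⟩` the arithmetic
lemma `apriori_arith` closes `‖v‖₂² + b² ≤ 25ν⁻²(‖G‖₂² + s²)`.
-/

set_option linter.dupNamespace false

noncomputable section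

namespace Summit.AnomalousDissipation.AnomalousDissipation.Theorems.NewtonRealisation.Negative

open MeasureTheory
open scoped InnerProductSpace RealInnerProductSpace
open Literature.Analysis.FluidPDE Literature.Analysis.FluidPDE.Torus
open Literature.Analysis.FunctionSpaces Literature.Analysis.FunctionSpaces.Torus
open Summit.AnomalousDissipation.AnomalousDissipation.Theorems.EnsembleRigidity.GPStatisticalRigidity
  (gpForce_fderiv_stokesMode_sin gpForce_integral_norm_sq_stokesMode)
open Summit.AnomalousDissipation.AnomalousDissipation.Theorems (AcdcStrain.partialDeriv_stokesMode_sin)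

/-! ## The two energy pairings of the bordered image at the shear state -/

section Pairings

variable {a : EuclideanSpace ℝ (Fin 3)} {ν b : ℝ}
  {v : UnitAddTorus (Fin 3) → EuclideanSpace ℝ (Fin 3)} {r : UnitAddTorus (Fin 3) → ℝ}

/-- The bordered image of a test triple `(v, r, b)` at the shear state (drift `c = 0`) is smooth. -/
theorem isSmooth_image (a : EuclideanSpace ℝ (Fin 3)) (ν b : ℝ) (hv : IsSmooth v)
    (hr : IsSmooth r) :
    IsSmooth (fun x => convect (⇑(stokesMode (Pi.single (2 : Fin 3) (1 : ℤ)) a false)) v x +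
      convect v (⇑(stokesMode (Pi.single (2 : Fin 3) (1 : ℤ)) a false)) x - ν • laplacian v x +
      Torus.gradient r x - (0 : ℝ) • partialDeriv (2 : Fin 3) v x -
      b • partialDeriv (2 : Fin 3) (⇑(stokesMode (Pi.single (2 : Fin 3) (1 : ℤ)) a false)) x) := by
  have hS : IsSmooth (⇑(stokesMode (Pi.single (2 : Fin 3) (1 : ℤ)) a false)) := isSmooth_stokesMode _ _ _
  exact (((((hS.convect hv).add (hv.convect hS)).sub (hv.laplacian.smul ν)).add hr.gradient).sub
    ((hv.partialDeriv 2).smul 0)).sub ((hS.partialDeriv 2).smul b)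

/-- **Pairing with the test field.** `(4π²ν − 2π‖a‖) ‖v‖₂² ≤ ‖G‖₂‖v‖₂ + |b| |s|`. -/
theorem pairing_self (ha : a 2 = 0) (hν : 0 ≤ ν) (hv : IsSmooth v) (hr : IsSmooth r)
    (hvd : IsDivFree v) (hvm : HasZeroMean v) :
    (4 * Real.pi ^ 2 * ν - 2 * Real.pi * ‖a‖) * (∫ x, ‖v x‖ ^ 2) ≤
      Real.sqrt (∫ x, ‖convect (⇑(stokesMode (Pi.single (2 : Fin 3) (1 : ℤ)) a false)) v x +
          convect v (⇑(stokesMode (Pi.single (2 : Fin 3) (1 : ℤ)) a false)) x - ν • laplacian v x +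
          Torus.gradient r x - (0 : ℝ) • partialDeriv (2 : Fin 3) v x -
          b • partialDeriv (2 : Fin 3) (⇑(stokesMode (Pi.single (2 : Fin 3) (1 : ℤ)) a false)) x‖ ^ 2) *
        Real.sqrt (∫ x, ‖v x‖ ^ 2) +
      |b| * |∫ x, ⟪v x, partialDeriv (2 : Fin 3) (⇑(stokesMode (Pi.single (2 : Fin 3) (1 : ℤ)) a false)) x⟫_ℝ| := by
  set S : UnitAddTorus (Fin 3) → EuclideanSpace ℝ (Fin 3) :=
    ⇑(stokesMode (Pi.single (2 : Fin 3) (1 : ℤ)) a false) with hS_def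
  have hS : IsSmooth S := isSmooth_stokesMode _ _ _
  have hSd : IsDivFree S := isDivFree_stokesMode (transversal_of_apply_two ha) _
  have hG : IsSmooth (fun x => convect S v x + convect v S x - ν • laplacian v x +
      Torus.gradient r x - (0 : ℝ) • partialDeriv (2 : Fin 3) v x - b • partialDeriv (2 : Fin 3) S x) :=
    isSmooth_image a ν b hv hr
  -- the exact identity
  have hsplit := integral_inner_image_split hS hv hr hv ν 0 b (2 : Fin 3)
  have t1 : ∫ x, ⟪convect S v x, v x⟫_ℝ = 0 := integral_inner_convect_eq_zero hS hv hSd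
  have t3 : ∫ x, ⟪laplacian v x, v x⟫_ℝ = -gradNormSq v :=
    integral_inner_laplacian_self_eq_neg_gradNormSq_of_isSmooth hv
  have t4 : ∫ x, ⟪Torus.gradient r x, v x⟫_ℝ = 0 := integral_inner_gradient_eq_zero_of_isDivFree hv hr hvd
  have t6 : ∫ x, ⟪partialDeriv (2 : Fin 3) S x, v x⟫_ℝ = ∫ x, ⟪v x, partialDeriv (2 : Fin 3) S x⟫_ℝ :=
    integral_congr_ae (ae_of_all _ fun x => real_inner_comm _ _)
  -- the stretching term is bounded by `2π‖a‖ ‖v‖²`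
  have t2 : -(∫ x, ⟪convect v S x, v x⟫_ℝ) ≤ 2 * Real.pi * ‖a‖ * ∫ x, ‖v x‖ ^ 2 := by
    rw [← integral_neg, ← integral_const_mul]
    refine integral_mono ((hv.convect hS).inner hv).integrable.neg
      (hv.norm_sq.integrable.const_mul _) fun x => ?_
    have hpt : ‖convect v S x‖ ≤ 2 * Real.pi * ‖a‖ * ‖v x‖ := by
      rw [hS_def, convect_left_sinMode, norm_smul]
      have h3 : |v x 2| ≤ ‖v x‖ := by
        simpa using PiLp.norm_apply_le (p := 2) (v x) 2
      have hC := norm_stokesMode_le (Pi.single (2 : Fin 3) (1 : ℤ)) a true x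
      calc ‖2 * Real.pi * v x 2‖ * ‖stokesMode (Pi.single (2 : Fin 3) (1 : ℤ)) a true x‖
          = 2 * Real.pi * |v x 2| * ‖stokesMode (Pi.single (2 : Fin 3) (1 : ℤ)) a true x‖ := by
            rw [Real.norm_eq_abs, abs_mul, abs_of_pos (by positivity : (0:ℝ) < 2 * Real.pi)]
        _ ≤ 2 * Real.pi * ‖v x‖ * ‖a‖ := by gcongr
        _ = 2 * Real.pi * ‖a‖ * ‖v x‖ := by ring
    have hcs : |⟪convect v S x, v x⟫_ℝ| ≤ ‖convect v S x‖ * ‖v x‖ := abs_real_inner_le_norm _ _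
    have := neg_abs_le (⟪convect v S x, v x⟫_ℝ)
    have hvv : ‖convect v S x‖ * ‖v x‖ ≤ 2 * Real.pi * ‖a‖ * ‖v x‖ * ‖v x‖ :=
      mul_le_mul_of_nonneg_right hpt (norm_nonneg _)
    calc -⟪convect v S x, v x⟫_ℝ ≤ |⟪convect v S x, v x⟫_ℝ| := neg_le_abs _
      _ ≤ 2 * Real.pi * ‖a‖ * ‖v x‖ ^ 2 := by nlinarith [hcs, hvv]
  -- Cauchy–Schwarz for the left-hand side and Poincaré
  have hcs := abs_integral_inner_le_sqrt_mul_sqrt (hG.memLp 2) (hv.memLp 2)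
  have hP := four_pi_sq_mul_integral_norm_sq_le_gradNormSq hv hvm
  have hbs : b * ∫ x, ⟪v x, partialDeriv (2 : Fin 3) S x⟫_ℝ ≤
      |b| * |∫ x, ⟪v x, partialDeriv (2 : Fin 3) S x⟫_ℝ| := by
    rw [← abs_mul]; exact le_abs_self _
  have hle := le_abs_self (∫ x, ⟪convect S v x + convect v S x - ν • laplacian v x +
      Torus.gradient r x - (0 : ℝ) • partialDeriv (2 : Fin 3) v x - b • partialDeriv (2 : Fin 3) S x, v x⟫_ℝ)
  rw [t1, t3, t4, t6] at hsplit
  have hV0 : 0 ≤ ∫ x, ‖v x‖ ^ 2 := integral_nonneg fun _ => by positivity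
  nlinarith [hsplit, t2, hcs, hP, hbs, hle, mul_le_mul_of_nonneg_left hP hν]

/-- **Pairing with the cosine partner `C = cos(2πx₃) a`.**
`|b| π‖a‖² ≤ 2π‖a‖²‖v‖₂ + 4π²ν |∫⟪v, C⟫| + ‖G‖₂ ‖a‖`. -/
theorem pairing_cos (ha : a 2 = 0) (hν : 0 ≤ ν) (hv : IsSmooth v) (hr : IsSmooth r) :
    |b| * (Real.pi * ‖a‖ ^ 2) ≤
      2 * Real.pi * ‖a‖ ^ 2 * Real.sqrt (∫ x, ‖v x‖ ^ 2) +
      4 * Real.pi ^ 2 * ν * |∫ x, ⟪v x, stokesMode (Pi.single (2 : Fin 3) (1 : ℤ)) a true x⟫_ℝ| +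
      Real.sqrt (∫ x, ‖convect (⇑(stokesMode (Pi.single (2 : Fin 3) (1 : ℤ)) a false)) v x +
          convect v (⇑(stokesMode (Pi.single (2 : Fin 3) (1 : ℤ)) a false)) x - ν • laplacian v x +
          Torus.gradient r x - (0 : ℝ) • partialDeriv (2 : Fin 3) v x -
          b • partialDeriv (2 : Fin 3) (⇑(stokesMode (Pi.single (2 : Fin 3) (1 : ℤ)) a false)) x‖ ^ 2) * ‖a‖ := by
  set S : UnitAddTorus (Fin 3) → EuclideanSpace ℝ (Fin 3) :=
    ⇑(stokesMode (Pi.single (2 : Fin 3) (1 : ℤ)) a false) with hS_def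
  set Cc : UnitAddTorus (Fin 3) → EuclideanSpace ℝ (Fin 3) :=
    ⇑(stokesMode (Pi.single (2 : Fin 3) (1 : ℤ)) a true) with hC_def
  have hS : IsSmooth S := isSmooth_stokesMode _ _ _
  have hSd : IsDivFree S := isDivFree_stokesMode (transversal_of_apply_two ha) _
  have hC : IsSmooth Cc := isSmooth_stokesMode _ _ _
  have hCd : IsDivFree Cc := isDivFree_stokesMode (transversal_of_apply_two ha) _
  have hG : IsSmooth (fun x => convect S v x + convect v S x - ν • laplacian v x +
      Torus.gradient r x - (0 : ℝ) • partialDeriv (2 : Fin 3) v x - b • partialDeriv (2 : Fin 3) S x) :=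
    isSmooth_image a ν b hv hr
  have hsplit := integral_inner_image_split hS hv hr hC ν 0 b (2 : Fin 3)
  -- (u1) transport term vanishes: antisymmetry and `(S·∇)C = 0`
  have u1 : ∫ x, ⟪convect S v x, Cc x⟫_ℝ = 0 := by
    rw [integral_inner_convect_antisymm hS hSd hv hC]
    have h0 : (fun x => ⟪v x, convect S Cc x⟫_ℝ) = fun _ => (0 : ℝ) := by
      funext x
      rw [hS_def, hC_def, convect_sinMode_cosMode ha x, inner_zero_right]
    rw [h0, integral_zero, neg_zero]
  -- (u3) the viscous term: `∫⟪Δv, C⟫ = -4π² ∫⟪v, C⟫`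
  have u3 : ∫ x, ⟪laplacian v x, Cc x⟫_ℝ = -(4 * Real.pi ^ 2) * ∫ x, ⟪v x, Cc x⟫_ℝ := by
    rw [integral_inner_laplacian_comm hv hC, ← integral_const_mul]
    refine integral_congr_ae (ae_of_all _ fun x => ?_)
    dsimp only
    rw [hC_def, laplacian_axialMode, inner_smul_right]
  -- (u4) pressure term vanishes
  have u4 : ∫ x, ⟪Torus.gradient r x, Cc x⟫_ℝ = 0 := integral_inner_gradient_eq_zero_of_isDivFree hC hr hCd
  -- (u6) the border pairing: `∫⟪∂₃S, C⟫ = 2π ∫‖C‖² = π‖a‖²`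
  have u6 : ∫ x, ⟪partialDeriv (2 : Fin 3) S x, Cc x⟫_ℝ = Real.pi * ‖a‖ ^ 2 := by
    have h1 : (fun x => ⟪partialDeriv (2 : Fin 3) S x, Cc x⟫_ℝ) = fun x => (2 * Real.pi) * ‖Cc x‖ ^ 2 := by
      funext x
      rw [hS_def, partialDeriv_two_sinMode, real_inner_smul_left, real_inner_self_eq_norm_sq]
    rw [h1, integral_const_mul, hC_def, gpForce_integral_norm_sq_stokesMode axial_ne_zero]
    ring
  -- (u2) the stretching term is bounded by `2π‖a‖² ‖v‖₂`
  have hCC : ∫ x, ‖Cc x‖ ^ 2 = ‖a‖ ^ 2 / 2 := by rw [hC_def, gpForce_integral_norm_sq_stokesMode axial_ne_zero]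
  have hsqC : Real.sqrt (∫ x, ‖Cc x‖ ^ 2) ≤ ‖a‖ := by
    rw [hCC]
    calc Real.sqrt (‖a‖ ^ 2 / 2) ≤ Real.sqrt (‖a‖ ^ 2) :=
          Real.sqrt_le_sqrt (by nlinarith [sq_nonneg ‖a‖])
      _ = ‖a‖ := Real.sqrt_sq (norm_nonneg _)
  have u2 : |∫ x, ⟪convect v S x, Cc x⟫_ℝ| ≤ 2 * Real.pi * ‖a‖ ^ 2 * Real.sqrt (∫ x, ‖v x‖ ^ 2) := by
    have hpt : ∀ x, |⟪convect v S x, Cc x⟫_ℝ| ≤ 2 * Real.pi * ‖a‖ * (‖v x‖ * ‖Cc x‖) := by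
      intro x
      have hn : ‖convect v S x‖ ≤ 2 * Real.pi * ‖a‖ * ‖v x‖ := by
        rw [hS_def, convect_left_sinMode, norm_smul]
        have h3 : |v x 2| ≤ ‖v x‖ := by simpa using PiLp.norm_apply_le (p := 2) (v x) 2
        have hCx := norm_stokesMode_le (Pi.single (2 : Fin 3) (1 : ℤ)) a true x
        calc ‖2 * Real.pi * v x 2‖ * ‖stokesMode (Pi.single (2 : Fin 3) (1 : ℤ)) a true x‖
            = 2 * Real.pi * |v x 2| * ‖stokesMode (Pi.single (2 : Fin 3) (1 : ℤ)) a true x‖ := by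
              rw [Real.norm_eq_abs, abs_mul, abs_of_pos (by positivity : (0:ℝ) < 2 * Real.pi)]
          _ ≤ 2 * Real.pi * ‖v x‖ * ‖a‖ := by gcongr
          _ = 2 * Real.pi * ‖a‖ * ‖v x‖ := by ring
      calc |⟪convect v S x, Cc x⟫_ℝ| ≤ ‖convect v S x‖ * ‖Cc x‖ := abs_real_inner_le_norm _ _
        _ ≤ 2 * Real.pi * ‖a‖ * ‖v x‖ * ‖Cc x‖ := mul_le_mul_of_nonneg_right hn (norm_nonneg _)
        _ = 2 * Real.pi * ‖a‖ * (‖v x‖ * ‖Cc x‖) := by ring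
    have hint : Integrable (fun x => ⟪convect v S x, Cc x⟫_ℝ) volume := ((hv.convect hS).inner hC).integrable
    have hprod : Integrable (fun x => ‖v x‖ * ‖Cc x‖) volume :=
      (hv.memLp 2).norm.integrable_mul (hC.memLp 2).norm
    calc |∫ x, ⟪convect v S x, Cc x⟫_ℝ| ≤ ∫ x, |⟪convect v S x, Cc x⟫_ℝ| := abs_integral_le_integral_abs
      _ ≤ ∫ x, 2 * Real.pi * ‖a‖ * (‖v x‖ * ‖Cc x‖) :=
          integral_mono hint.abs (hprod.const_mul _) hpt
      _ = 2 * Real.pi * ‖a‖ * ∫ x, ‖v x‖ * ‖Cc x‖ := integral_const_mul _ _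
      _ ≤ 2 * Real.pi * ‖a‖ * (Real.sqrt (∫ x, ‖v x‖ ^ 2) * Real.sqrt (∫ x, ‖Cc x‖ ^ 2)) :=
          mul_le_mul_of_nonneg_left (integral_norm_mul_norm_le (hv.memLp 2) (hC.memLp 2))
            (by positivity)
      _ ≤ 2 * Real.pi * ‖a‖ * (Real.sqrt (∫ x, ‖v x‖ ^ 2) * ‖a‖) :=
          mul_le_mul_of_nonneg_left (mul_le_mul_of_nonneg_left hsqC (Real.sqrt_nonneg _))
            (by positivity)
      _ = 2 * Real.pi * ‖a‖ ^ 2 * Real.sqrt (∫ x, ‖v x‖ ^ 2) := by ring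
  -- Cauchy–Schwarz for the left-hand side
  have hcs := abs_integral_inner_le_sqrt_mul_sqrt (hG.memLp 2) (hC.memLp 2)
  rw [u1, u3, u4, u6] at hsplit
  -- `b π‖a‖² = (stretching) + 4π²ν σ − ∫⟪G, C⟫`
  have hb : b * (Real.pi * ‖a‖ ^ 2) = (∫ x, ⟪convect v S x, Cc x⟫_ℝ) +
      4 * Real.pi ^ 2 * ν * (∫ x, ⟪v x, Cc x⟫_ℝ) -
      ∫ x, ⟪convect S v x + convect v S x - ν • laplacian v x + Torus.gradient r x -
        (0 : ℝ) • partialDeriv (2 : Fin 3) v x - b • partialDeriv (2 : Fin 3) S x, Cc x⟫_ℝ := by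
    linarith
  have hσ : |4 * Real.pi ^ 2 * ν * ∫ x, ⟪v x, Cc x⟫_ℝ| = 4 * Real.pi ^ 2 * ν * |∫ x, ⟪v x, Cc x⟫_ℝ| := by
    rw [abs_mul, abs_of_nonneg (by positivity : (0:ℝ) ≤ 4 * Real.pi ^ 2 * ν)]
  have hGa : Real.sqrt (∫ x, ‖convect S v x + convect v S x - ν • laplacian v x + Torus.gradient r x -
        (0 : ℝ) • partialDeriv (2 : Fin 3) v x - b • partialDeriv (2 : Fin 3) S x‖ ^ 2) *
        Real.sqrt (∫ x, ‖Cc x‖ ^ 2) ≤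
      Real.sqrt (∫ x, ‖convect S v x + convect v S x - ν • laplacian v x + Torus.gradient r x -
        (0 : ℝ) • partialDeriv (2 : Fin 3) v x - b • partialDeriv (2 : Fin 3) S x‖ ^ 2) * ‖a‖ :=
    mul_le_mul_of_nonneg_left hsqC (Real.sqrt_nonneg _)
  calc |b| * (Real.pi * ‖a‖ ^ 2) = |b * (Real.pi * ‖a‖ ^ 2)| := by
        rw [abs_mul, abs_of_nonneg (by positivity : (0:ℝ) ≤ Real.pi * ‖a‖ ^ 2)]
    _ ≤ |∫ x, ⟪convect v S x, Cc x⟫_ℝ| + |4 * Real.pi ^ 2 * ν * ∫ x, ⟪v x, Cc x⟫_ℝ| +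
        |∫ x, ⟪convect S v x + convect v S x - ν • laplacian v x + Torus.gradient r x -
          (0 : ℝ) • partialDeriv (2 : Fin 3) v x - b • partialDeriv (2 : Fin 3) S x, Cc x⟫_ℝ| := by
        rw [hb]; exact (abs_sub _ _).trans (add_le_add (abs_add_le _ _) le_rfl)
    _ ≤ 2 * Real.pi * ‖a‖ ^ 2 * Real.sqrt (∫ x, ‖v x‖ ^ 2) +
        4 * Real.pi ^ 2 * ν * |∫ x, ⟪v x, Cc x⟫_ℝ| +
        Real.sqrt (∫ x, ‖convect S v x + convect v S x - ν • laplacian v x + Torus.gradient r x -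
          (0 : ℝ) • partialDeriv (2 : Fin 3) v x - b • partialDeriv (2 : Fin 3) S x‖ ^ 2) * ‖a‖ := by
        rw [hσ]; exact add_le_add (add_le_add u2 le_rfl) (hcs.trans hGa)

/-- The border functional against the test field is `2π ∫⟪v, C⟫`. -/
theorem border_eq (v : UnitAddTorus (Fin 3) → EuclideanSpace ℝ (Fin 3)) :
    ∫ x, ⟪v x, partialDeriv (2 : Fin 3) (⇑(stokesMode (Pi.single (2 : Fin 3) (1 : ℤ)) a false)) x⟫_ℝ =
      2 * Real.pi * ∫ x, ⟪v x, stokesMode (Pi.single (2 : Fin 3) (1 : ℤ)) a true x⟫_ℝ := by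
  rw [← integral_const_mul]
  refine integral_congr_ae (ae_of_all _ fun x => ?_)
  dsimp only
  rw [partialDeriv_two_sinMode, real_inner_smul_right]

end Pairings

/-! ## Arithmetic and assembly -/

/-- The real-arithmetic core: the two pairing inequalities force the a-priori bound. -/
theorem apriori_arith {x g t B ν : ℝ} (ht : 0 ≤ t) (hB : 0 ≤ B)
    (hν : 0 < ν) (hA : 30 * ν * x ^ 2 ≤ g * x + B * t)
    (hB' : B * ν ≤ 2 * t + 2 * ν * x + g / 3) :
    x ^ 2 + B ^ 2 ≤ (5 * ν⁻¹) ^ 2 * (g ^ 2 + t ^ 2) := by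
  have h1 : 30 * ν ^ 2 * x ^ 2 ≤ ν * g * x + 2 * t ^ 2 + 2 * ν * x * t + g * t / 3 := by
    have e1 := mul_le_mul_of_nonneg_left hA hν.le
    have e2 := mul_le_mul_of_nonneg_right hB' ht
    nlinarith [e1, e2]
  have h2 : 10 * ν ^ 2 * x ^ 2 ≤ g ^ 2 / 40 + 2 * t ^ 2 + t ^ 2 / 10 + (g ^ 2 + t ^ 2) / 6 := by
    nlinarith [h1, sq_nonneg (20 * ν * x - g), sq_nonneg (20 * ν * x - 2 * t), sq_nonneg (g - t)]
  have hBν : 0 ≤ B * ν := mul_nonneg hB hν.le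
  have h3 : (B * ν) ^ 2 ≤ 3 * (4 * t ^ 2 + 4 * ν ^ 2 * x ^ 2 + g ^ 2 / 9) := by
    have e3 : (B * ν) ^ 2 ≤ (2 * t + 2 * ν * x + g / 3) ^ 2 := by
      exact pow_le_pow_left₀ hBν hB' 2
    nlinarith [e3, sq_nonneg (2 * t - 2 * ν * x), sq_nonneg (2 * ν * x - g / 3), sq_nonneg (2 * t - g / 3)]
  have hkey : (x ^ 2 + B ^ 2) * ν ^ 2 ≤ 25 * (g ^ 2 + t ^ 2) := by nlinarith [h2, h3]
  have hν2 : 0 < ν ^ 2 := by positivity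
  rw [show (5 * ν⁻¹) ^ 2 * (g ^ 2 + t ^ 2) = 25 * (g ^ 2 + t ^ 2) / ν ^ 2 by
    field_simp; ring]
  rw [le_div_iff₀ hν2]
  exact hkey


section Assembly

/-- The amplitude `ν e₀` is horizontal. -/
theorem single_apply_two (ν : ℝ) : (EuclideanSpace.single (0 : Fin 3) ν) 2 = 0 := by
  simp

/-- `‖ν e₀‖ = ν` for `ν > 0`. -/
theorem norm_single_eq {ν : ℝ} (hν : 0 < ν) : ‖EuclideanSpace.single (0 : Fin 3) ν‖ = ν := by
  simp [abs_of_pos hν]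

/-- `4π² − 2π ≥ 30`. -/
theorem thirty_le : (30 : ℝ) ≤ 4 * Real.pi ^ 2 - 2 * Real.pi := by
  nlinarith [Real.pi_gt_three]

/-- **THE BORDERED A-PRIORI BOUND IS INHABITED.** For every viscosity `0 < ν`, the axial shear
state `u₀ = ν sin(2πx₃) e₀` (`Torus.stokesMode e₃ (ν e₀) false`) with drift `c = 0` satisfies the
crux's bordered `L²` a-priori bound — verbatim the last clause of
`NeutralTaylorWaves.NonresonantTaylorWaves` / the hypothesis `BorderedBound ν M u₀ c` of the line's
transfer `C⁺` — with the explicit constant `M = 5/ν`: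
`∫‖v‖² + b² ≤ (5ν⁻¹)² (‖u₀·∇v + v·∇u₀ − νΔv + ∇r − 0·∂₃v − b∂₃u₀‖₂² + ⟨v, ∂₃u₀⟩²)`
for all smooth divergence-free mean-zero `v`, smooth `r`, real `b`.  Proof: energy method — pair the
image with `v` (transport vanishes, stretching `≥ −2πν‖v‖²`, Poincaré `4π²`) and with the cosine
partner `cos(2πx₃) νe₀` (transport vanishes by antisymmetry, `Δ` has eigenvalue `−4π²`, the border
pairing is `πν²`), then elementary arithmetic. -/
theorem borderedBound_shear {ν : ℝ} (hν : 0 < ν) :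
    ∀ (v : UnitAddTorus (Fin 3) → EuclideanSpace ℝ (Fin 3)) (r : UnitAddTorus (Fin 3) → ℝ) (b : ℝ),
      IsSmooth v → IsSmooth r → IsDivFree v → HasZeroMean v →
      MeasureTheory.integral MeasureTheory.volume (fun x => ‖v x‖ ^ 2) + b ^ 2 ≤
        (5 * ν⁻¹) ^ 2 * (MeasureTheory.integral MeasureTheory.volume (fun x =>
          ‖Torus.convect (⇑(stokesMode (Pi.single (2 : Fin 3) (1 : ℤ)) (EuclideanSpace.single (0 : Fin 3) ν) false)) v x +
            Torus.convect v (⇑(stokesMode (Pi.single (2 : Fin 3) (1 : ℤ)) (EuclideanSpace.single (0 : Fin 3) ν) false)) x -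
            ν • Torus.laplacian v x + Torus.gradient r x - (0 : ℝ) • Torus.partialDeriv (2 : Fin 3) v x -
            b • Torus.partialDeriv (2 : Fin 3)
              (⇑(stokesMode (Pi.single (2 : Fin 3) (1 : ℤ)) (EuclideanSpace.single (0 : Fin 3) ν) false)) x‖ ^ 2) +
          (MeasureTheory.integral MeasureTheory.volume (fun x => inner ℝ (v x)
            (Torus.partialDeriv (2 : Fin 3)
              (⇑(stokesMode (Pi.single (2 : Fin 3) (1 : ℤ)) (EuclideanSpace.single (0 : Fin 3) ν) false)) x))) ^ 2) := by
  intro v r b hv hr hvd hvm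
  have ha := single_apply_two ν
  have hna := norm_single_eq hν
  have hA := pairing_self (b := b) ha hν.le hv hr hvd hvm
  have hB := pairing_cos (b := b) ha hν.le hv hr
  have hs := border_eq (a := EuclideanSpace.single (0 : Fin 3) ν) v
  rw [hna] at hA hB
  -- abbreviations
  set V : ℝ := ∫ x, ‖v x‖ ^ 2 with hV
  set Γ : ℝ := ∫ x, ‖Torus.convect (⇑(stokesMode (Pi.single (2 : Fin 3) (1 : ℤ)) (EuclideanSpace.single (0 : Fin 3) ν) false)) v x +
      Torus.convect v (⇑(stokesMode (Pi.single (2 : Fin 3) (1 : ℤ)) (EuclideanSpace.single (0 : Fin 3) ν) false)) x -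
      ν • Torus.laplacian v x + Torus.gradient r x - (0 : ℝ) • Torus.partialDeriv (2 : Fin 3) v x -
      b • Torus.partialDeriv (2 : Fin 3)
        (⇑(stokesMode (Pi.single (2 : Fin 3) (1 : ℤ)) (EuclideanSpace.single (0 : Fin 3) ν) false)) x‖ ^ 2 with hΓ
  set s : ℝ := ∫ x, ⟪v x, Torus.partialDeriv (2 : Fin 3)
      (⇑(stokesMode (Pi.single (2 : Fin 3) (1 : ℤ)) (EuclideanSpace.single (0 : Fin 3) ν) false)) x⟫_ℝ with hs_def
  set σ : ℝ := ∫ x, ⟪v x, stokesMode (Pi.single (2 : Fin 3) (1 : ℤ)) (EuclideanSpace.single (0 : Fin 3) ν) true x⟫_ℝ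
    with hσ_def
  have hV0 : 0 ≤ V := integral_nonneg fun _ => by positivity
  have hΓ0 : 0 ≤ Γ := integral_nonneg fun _ => by positivity
  -- the variables of the arithmetic lemma
  set x : ℝ := Real.sqrt V with hx
  set g : ℝ := Real.sqrt Γ with hg
  have hxV : x ^ 2 = V := Real.sq_sqrt hV0
  have hgΓ : g ^ 2 = Γ := Real.sq_sqrt hΓ0
  have hx0 : 0 ≤ x := Real.sqrt_nonneg _
  have hg0 : 0 ≤ g := Real.sqrt_nonneg _
  -- (A): `30 ν x² ≤ g x + |b| |s|`
  have hA' : 30 * ν * x ^ 2 ≤ g * x + |b| * |s| := by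
    rw [hxV]
    have h30 : 30 * ν * V ≤ (4 * Real.pi ^ 2 * ν - 2 * Real.pi * ν) * V := by
      have := thirty_le
      have hνV : 0 ≤ ν * V := mul_nonneg hν.le hV0
      nlinarith
    exact h30.trans hA
  -- (B): `|b| ν ≤ 2|s| + 2ν x + g/3`
  have hσs : |σ| = |s| / (2 * Real.pi) := by
    rw [hs, abs_mul, abs_of_pos (by positivity : (0:ℝ) < 2 * Real.pi)]
    field_simp
  have hB' : |b| * ν ≤ 2 * |s| + 2 * ν * x + g / 3 := by
    have hπ := Real.pi_gt_three
    have hπν : 0 < Real.pi * ν := by positivity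
    -- divide (B) by `πν`
    have hB1 : |b| * ν * (Real.pi * ν) ≤ (2 * ν * x + 2 * |s| + g / Real.pi) * (Real.pi * ν) := by
      have e : |b| * (Real.pi * ν ^ 2) = |b| * ν * (Real.pi * ν) := by ring
      have e2 : 2 * Real.pi * ν ^ 2 * x + 4 * Real.pi ^ 2 * ν * |σ| + g * ν =
          (2 * ν * x + 2 * |s| + g / Real.pi) * (Real.pi * ν) := by
        rw [hσs]; field_simp; ring
      rw [← e, ← e2]; exact hB
    have hB2 : |b| * ν ≤ 2 * ν * x + 2 * |s| + g / Real.pi := le_of_mul_le_mul_right hB1 hπν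
    have hgπ : g / Real.pi ≤ g / 3 := div_le_div_of_nonneg_left hg0 (by norm_num) hπ.le
    linarith
  have key := apriori_arith (abs_nonneg s) (abs_nonneg b) hν hA' hB'
  rw [hxV, hgΓ, sq_abs, sq_abs] at key
  exact key

end Assembly



end Summit.AnomalousDissipation.AnomalousDissipation.Theorems.NewtonRealisation.Negative

end
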